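import Literature.NumberTheory.EllipticCurves.CastellaHsieh2018.BranchBDPLFunctionExistence
import HarnessLib

/-!
# Castella–Hsieh 2018, Def. 3.7 + Prop. 3.8 on the `χ`-branch of conductor `p` — SIGNED form of the existence fact:
# the branch frame can be taken with branch constant a SIGN, `e = ε(½, χ_𝔭)⁻² ∈ {1, −1}`

F. Castella, M.-L. Hsieh, *Heegner cycles and p-adic L-functions*, Math. Ann. **370** (2018) 567–628 =
arXiv:1505.08165v1 (held `paper:arxiv-1505.08165`; v1 TeX pages quoted `pNNNN:Lnn`, journal numbering in brackets).
Companion of `BranchBDPLFunctionExistence.lean` (the named fact `castellaHsieh2018_exists_isBranchBDPLFunction`, which pins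
only `e ≠ 0`) and of `BranchBDPLFunctionValueAtConductorPSigned.lean` (the SIGNED VALUE fact
`castellaHsieh2018_branchValue_conductorP_signed` = "V⁺", whose first three conjuncts are exactly the statement below, but
which carries the hypotheses of the VALUE formula Lemma 5.4 + Thm. 5.7 — `p ∤ φ(N)`, `f` ordinary at `p`, a parametrisation
datum and an orientation — that the EXISTENCE statement Def. 3.7 + Prop. 3.8 does not need).  This file records the
existence-with-sign ALONE, under the existence fact's hypotheses plus `d_K` odd and `≠ −3` (the setting in which V⁺'s
reading of the constants was audited).  ONE named fact + one proved consequence; no `sorry`, no instance, no notation;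
the two sibling files are untouched (their audited bytes stay; ARM-P ruling PIN-SEPARATE, `pub/bsd-stepL/INBOX.md`
2026-08-27T10:35:46Z (3): "an e = ±1 unit-pin form is a different statement ⇒ land it separately named").

## Why the constant is a sign (what is printed; the reading is that of V⁺'s module docstring, verbatim in substance)

* [CastellaHsieh2018] §3.3, the multiplier of the interpolation formula (p0010:L16–L20, display before Prop. 3.4 [journal:
  before Prop. 3.6]): "define the multiplier `e_𝔭(f,χ)` by `e_𝔭(f,χ) = (1 − 𝐚_p(f)p^{−r}χ_𝔭̄(p) + χ_𝔭̄(p²)p^{−1})²` if `p ∤ c`,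
  **`ε(½, χ_𝔭)^{−2}` if `p ∣ c`**" (`c𝒪_K` the conductor of `χ`); Prop. 3.6 [journal 3.8] (p0011:L7–L10): "If `φ̂ ∈ 𝔛_{p^∞}` is
  the avatar of a Hecke character `φ` of infinity type `(m, −m)` with `m ≥ 0` and `p`-power conductor, then
  `(ℒ_{𝔭,ψ}(f)(φ̂)/Ω_p^{2r+2m})² = L^{alg}(½, π_K ⊗ ψφ) · e_𝔭(f, ψφ) · φ(𝔑^{−1}) · 2^{#A(ψ)+3} c_o ε(f) · u_K² √D_K`", with
  periods "`(Ω_K, Ω_p) ∈ ℂ^× × 𝒲^×`" (p0007) and the local constant Tate's (p0004:L51–L55: "if `χ` is a character of conductor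
  `qⁿ`, then `ε(s, χ) = 𝔤(χ^{−1})·χ(−qⁿ)q^{−ns}`, `ε(s, χ)ε(1−s, χ^{−1}) = χ(−1)`").
* On the branch of a QUADRATIC `χ` of conductor exponent `1` above `p` (the fact's hypotheses; for `p` odd split these are the
  `χ_ε ν`, genus character times a quadratic class-group character — module docstring of `BranchBDPLFunctionExistence.lean`)
  the characters `χφ`, `φ` unramified of infinity type `(n, −n)`, have conductor `p𝒪_K`, so
  `e_𝔭(f, χφ) = ε(½, χ_𝔭φ_𝔭)^{−2} = ε(½, χ_𝔭)^{−2}·φ_𝔭(p)^{−2}` by the unramified-twist rule [TateNTB1979] (3.2.3)/(3.4.6) (up to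
  the sign `ν_𝔭(p)^{−2} = 1`), and for the quadratic `χ_𝔭` Tate's functional equation `ε(½,χ_𝔭)ε(½,χ_𝔭^{−1}) = χ_𝔭(−1)` with
  `χ_𝔭^{−1} = χ_𝔭` gives `ε(½, χ_𝔭)^{−2} = χ_𝔭(−1) ∈ {1, −1}` ([Bump1997] §1.1 (1.5) and Exercise 1.1.1: `τ(χ)² = χ(−1)·p` for a
  real primitive `χ` mod `p`).  The remaining `n`-INDEPENDENT constants of Prop. 3.6 [3.8] relative to Castella's
  reformulation (`IsBDPLFunction`; Castella 2018 Thm. 3.1, arXiv:1704.06608 p. 9, absorbs those of the trivial branch) —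
  `χ(𝔑^{−1}) = ±1`, `2^{#A(ψ)+3}` (`A(ψ) = ∅` under (Heeg)), `c_o` with `(c_o, pN⁺) = 1`, `ε(f) = ±1`, `u_K² = 1` (`d_K` odd,
  `≠ −3`), `√D_K ∈ 𝒲^×` (`p ∤ D_K`: `p` is split), the `4` of `(4π)^{2n+1} = 4·16^n·π^{2n+1}` — form, for `p` ODD and SPLIT in
  `K` of ODD discriminant `≠ −3`, a UNIT `A ∈ 𝒲^× = R₀^×`; the `n`-dependent `16^n (Im ϑ)^{2n}` go into `Ω_K^{4n}`
  (`Ω_K ↦ 2 (Im ϑ)^{1/2} Ω_K`) and `φ(𝔑^{−1}) = φ̂(σ_𝔑)` is the unit power series `(1+T)^{s_𝔑} ∈ ℤ_p⟦T⟧^×` at `T = φ̂(γ) − 1`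
  (`σ_𝔑 ≡ γ^{s_𝔑}`), absorbed into `L`.  Replacing the frame `L ∈ R₀⟦T⟧` of the unsigned fact by `A^{−1}·(1+T)^{−s_𝔑}·L ∈ R₀⟦T⟧`
  leaves `Ω_K ≠ 0`, `Ω_p ∈ R₀^×` and the interpolation property intact and makes the constant EXACTLY the sign `χ_𝔭(−1)`.
  WHICH sign (`(−1/p)` or `(−N/p)`, according to whether `χ(𝔑^{−1})` is kept in `e` or in `A`) is not asserted — only
  `e ∈ {1, −1}`, the shape the consumers carry (Keller–Yin's typed μ-clause, `KYRead.CHFrameValueVH`).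
* Why a separately named fact and not a corollary of the unsigned one: that fact records only `e ≠ 0`, and a frame
  rescaled by `ι⁻¹(1/e)` need not lie in `R₀⟦T⟧` (V⁺'s docstring, "Why the pin matters"); the sign is print's content
  (§3.3 + Tate), not a consequence of `e ≠ 0`.

## Scope / what is NOT claimed

Exactly as `castellaHsieh2018_exists_isBranchBDPLFunction` (weight 2, rational coefficients, `p` odd with `p ∤ N`, `p` split,
(Heeg), the three branch-character hypotheses; the scope caveats of `BDPBranchPAdicLFunction.lean` on `𝔭` vs `𝔭̄` and the
absorbed constants) plus `d_K` odd, `d_K ≠ −3`; nothing about frames OTHER than the one exhibited (frames are free up to a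
unit of `R₀` and a rescaling of the periods, so "every frame has `e = ±1`" is false); NO value formula (that is V / V⁺, with
their own hypotheses); no Iwasawa main-identity; nothing at `p ∣ N` or `p = 2`; which sign.  PUBLISHED / REFEREED source; the
derivation of the sign is the one audited for V⁺ (pub/bsd-cited D-AUDIT r08-Q63, 2026-08-27: "VERBATIM-COMPOSITE /
PUB-DERIVED").

Consumer: BSD route `SchneiderFreeAdditiveX3`, crux r3 `GordTwoBranchIMC` (stmt-BirchSwinnertonDyer-19177) and the rung leaf
`SchneiderFree.AdditiveX3RankOneLower` on the LZZ/♭ road (cell bsd-schneider-ideate, seat door-c5 gen 20): with Keller–Yin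
Thm. 3.5.1 (the two typed Keller–Yin branch claims, PREPRINT) a signed frame has `μ = 0` and
carries `Char_Λ(𝔛)·R₀⟦T⟧ = (L)`; by branch-vs-flat rigidity (`Theorems/SchneiderFreeAdditiveX3BranchFlatRigidity.lean`) a
signed branch frame and Hsieh's ♭-frame of `f̃ ⊗ ε` generate the same ideal of `𝓞_{ℂ_p}⟦T⟧` — the sign is what makes the
constant `ι⁻¹(e)` a `p`-adic unit.

* `castellaHsieh2018_exists_isBranchBDPLFunction_signed` — the named fact (ONE `def … : Prop`).
* `castellaHsieh2018_exists_isBranchBDPLFunction_signed.exists_ne_zero` — it yields the unsigned conclusion (`±1 ≠ 0`) at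
  its own data (PROVED).

References: [CastellaHsieh2018] §3.3 (display before Prop. 3.4 [journal 3.6]), Def. 3.5 / Prop. 3.6 [journal 3.7 / 3.8]
(arXiv:1505.08165v1 pp. 9–11), §4.1 (Heeg) (p. 12); [Castella2018] Thm. 3.1 (arXiv:1704.06608 p. 9), the normalisation;
[TateNTB1979] (3.2.3)/(3.4.6) and §3.4; [Bump1997] §1.1 (1.5), Exercise 1.1.1; [KellerYin2024b] §3.4 p. 19 (the name `ℒ_ε`
only; preprint).
-/

noncomputable section

open scoped Classical

open NumberField IsDedekindDomain Field Literature.NumberTheory.EllipticCurves.ModularForms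
open Literature.NumberTheory.GaloisRepresentations

universe u

namespace Literature.NumberTheory.EllipticCurves

/-- **Castella–Hsieh 2018, Definition 3.7 + Proposition 3.8 on the branch of a quadratic character of conductor `p𝒪_K`,
SIGNED form: the `χ`-branch `ℒ_𝔭(f)(χ̂ ·)` of the BDP anticyclotomic `p`-adic `L`-function exists with branch constant a
SIGN `e ∈ {1, −1}`** (`e = ε(½, χ_𝔭)^{−2} = χ_𝔭(−1)` by §3.3 "`e_𝔭(f,χ) = ε(½, χ_𝔭)^{−2}` if `p ∣ c`" and Tate's
`ε(½,χ)ε(½,χ^{−1}) = χ(−1)` for the quadratic `χ_𝔭`; the remaining `n`-independent constants of Prop. 3.8 — a unit of `𝒲`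
for `p` odd split and `d_K` odd `≠ −3`, and signs — absorbed into the frame `L ∈ R₀⟦T⟧`, so only `e ∈ {1, −1}` is asserted,
not which sign).  Hypotheses VERBATIM those of `castellaHsieh2018_exists_isBranchBDPLFunction` — `f` the newform of the
elliptic curve `W/ℚ` at level `N`, `p` an ODD prime with `p ∤ N`, `K` imaginary quadratic with `p = 𝔭𝔭̄` SPLIT, `𝔭`
singled out by the embedding datum `ι`, (Heeg) for `N`, `κ` THE anticyclotomic `ℤ_p`-extension with topological generator
`γ`, `χ` quadratic, unramified off `p`, of conductor exponent exactly `1` above `p` — PLUS `d_K` odd and `d_K ≠ −3` (the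
setting of the audited reading of the constants, `u_K = 1`).  Conclusion: a sign `e`, CM periods `Ω_K ≠ 0`, `Ω_p ∈ R₀^×`
and `L ∈ R₀⟦T⟧` with `IsBranchBDPLFunction ι 𝔭 κ γ f χ e Ω_K Ω_p L`.  A CONSEQUENCE of the printed statement exactly as the
unsigned sibling is (Castella 2018 Thm. 3.1's normalisation = Def. 3.7 read through `Tw_{ψ⁻¹}`, then `Tw_χ̂` and `Γ̃ ↠ Γ`).
PUBLISHED (Math. Ann. 370 (2018)); no value formula and no Iwasawa-theoretic identity here.
[cite: CastellaHsieh2018, §3.3 (display before Prop. 3.4 [journal: before Prop. 3.6]: e_𝔭 = ε(½,χ_𝔭)⁻² for p ∣ c), Def. 3.5 / Prop. 3.6 [journal Def. 3.7 / Prop. 3.8] (arXiv:1505.08165v1 pp. 10–11), §3.3 "anticyclotomic" (p. 9), §4.1 (Heeg) (p. 12)]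
[cite: TateNTB1979, (3.2.3)/(3.4.6) (unramified twist) and §3.4 (ε(s,χ)ε(1−s,χ⁻¹) = χ(−1))]
[cite: Bump1997, §1.1 (1.5) (p. 13) and Exercise 1.1.1 (p. 17): τ(χ)² = χ(−1)p for a real primitive χ mod p]
[cite: Castella2018, Thm. 3.1 and proof (arXiv:1704.06608 p. 9), the normalisation `IsBDPLFunction`] -/
def castellaHsieh2018_exists_isBranchBDPLFunction_signed : Prop :=
  ∀ {p : ℕ} [Fact p.Prime] (ι : PadicAlgCl p ≃+* ℂ) (W : WeierstrassCurve ℚ) [W.IsElliptic]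
    (K : Type) [Field K] [NumberField K] (𝔭 : HeightOneSpectrum (𝓞 K)) (κ : ZpExtension K p)
    (γ : absoluteGaloisGroup K) {N : ℕ} [NeZero N] {f : CuspForm (CongruenceSubgroup.Gamma0 N) 2}
    (_ : IsNewformOf W f) (χ : HeckeCharacter K),
    p ≠ 2 → ¬ p ∣ N →
    IsImaginaryQuadratic K → Odd (NumberField.discr K) → NumberField.discr K ≠ -3 →
    ((Ideal.span {(p : ℤ)}).primesOver (𝓞 K)).ncard = 2 →
    ((p : ℕ) : 𝓞 K) ∈ 𝔭.asIdeal →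
    (∀ (w : InfinitePlace K) (k : 𝓞 K),
      k ∈ 𝔭.asIdeal ↔ ‖ι.symm (w.embedding (k : K))‖ < 1) →
    SatisfiesHeegnerHypothesis N K →
    κ.IsAnticyclotomic → κ.IsTopGenerator γ →
    χ ^ 2 = 1 →
    (∀ w : HeightOneSpectrum (𝓞 K), ((p : ℕ) : 𝓞 K) ∉ w.asIdeal → χ.IsUnramifiedAt w) →
    (∀ 𝔮 : HeightOneSpectrum (𝓞 K), ((p : ℕ) : 𝓞 K) ∈ 𝔮.asIdeal → χ.HasConductorExponentAt 𝔮 1) →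
    ∃ (e : ℂ) (ΩK : ℂ) (Ωp : (unrIntegers p)ˣ) (L : UnrSeries p),
      (e = 1 ∨ e = -1) ∧ ΩK ≠ 0 ∧ IsBranchBDPLFunction ι 𝔭 κ γ f χ e ΩK ((Ωp : unrIntegers p) : ℂ_[p]) L

/-! ### API (proved) -/

/-- **The signed frame is in particular a frame with non-zero constant** (`±1 ≠ 0`): at the data of the signed fact the
conclusion of the unsigned `castellaHsieh2018_exists_isBranchBDPLFunction` holds.  Forgetting the sign; nothing asserted.
[cite: CastellaHsieh2018, Def. 3.7 and Prop. 3.8 (= arXiv v1 Def. 3.5 / Prop. 3.6)] -/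
theorem castellaHsieh2018_exists_isBranchBDPLFunction_signed.exists_ne_zero
    (h : castellaHsieh2018_exists_isBranchBDPLFunction_signed) {p : ℕ} [Fact p.Prime]
    (ι : PadicAlgCl p ≃+* ℂ) (W : WeierstrassCurve ℚ) [W.IsElliptic] (K : Type) [Field K] [NumberField K]
    (𝔭 : HeightOneSpectrum (𝓞 K)) (κ : ZpExtension K p) (γ : absoluteGaloisGroup K) {N : ℕ} [NeZero N]
    {f : CuspForm (CongruenceSubgroup.Gamma0 N) 2} (hf : IsNewformOf W f) (χ : HeckeCharacter K)
    (hp2 : p ≠ 2) (hpN : ¬ p ∣ N) (hK : IsImaginaryQuadratic K) (hodd : Odd (NumberField.discr K))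
    (hdK : NumberField.discr K ≠ -3) (hsplit : ((Ideal.span {(p : ℤ)}).primesOver (𝓞 K)).ncard = 2)
    (h𝔭 : ((p : ℕ) : 𝓞 K) ∈ 𝔭.asIdeal)
    (hι : ∀ (w : InfinitePlace K) (k : 𝓞 K), k ∈ 𝔭.asIdeal ↔ ‖ι.symm (w.embedding (k : K))‖ < 1)
    (hHe : SatisfiesHeegnerHypothesis N K) (hκ : κ.IsAnticyclotomic) (hγ : κ.IsTopGenerator γ) (hχ2 : χ ^ 2 = 1)
    (hχu : ∀ w : HeightOneSpectrum (𝓞 K), ((p : ℕ) : 𝓞 K) ∉ w.asIdeal → χ.IsUnramifiedAt w)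
    (hχc : ∀ 𝔮 : HeightOneSpectrum (𝓞 K), ((p : ℕ) : 𝓞 K) ∈ 𝔮.asIdeal → χ.HasConductorExponentAt 𝔮 1) :
    ∃ (e : ℂ) (ΩK : ℂ) (Ωp : (unrIntegers p)ˣ) (L : UnrSeries p),
      e ≠ 0 ∧ ΩK ≠ 0 ∧ IsBranchBDPLFunction ι 𝔭 κ γ f χ e ΩK ((Ωp : unrIntegers p) : ℂ_[p]) L := by
  obtain ⟨e, ΩK, Ωp, L, he, hΩ, hL⟩ :=
    h ι W K 𝔭 κ γ hf χ hp2 hpN hK hodd hdK hsplit h𝔭 hι hHe hκ hγ hχ2 hχu hχc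
  exact ⟨e, ΩK, Ωp, L, by rcases he with rfl | rfl <;> norm_num, hΩ, hL⟩

end Literature.NumberTheory.EllipticCurves

end
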